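/-
Copyright (c) 2026. Released under the Apache 2.0 license.
-/
import Summits.BirchSwinnertonDyer.BirchSwinnertonDyer.Cruxes.ManinPrimeToAdditiveFiveLe.Lines.neron_partner
import Literature.FieldTheory.AlgClosed.PadicAlgClEquivComplex
import HarnessLib

/-!
# Line `regular_mult_one` for crux C5 = `ManinLocalTwoThree.ManinPrimeToAdditiveFiveLe`
# (ideator bsd-idea-8 g10, lens NEAR-MISS; crux item stmt-BirchSwinnertonDyer-22969)

**Published line, NOT the skeleton of record** (W-79; record = `Lines/upper_anchor.lean`, LEAD
ml23-c5-p1). Card: `Lines/regular-mult-one.md`; crux idea: `Ideas/regular-multiplicity-one.md`.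
BSD is not proved by any of this.

REV 1.1 (critic V#111 PASS-WITH-PRICE, P4 hygiene): the unused binder `N` in the lambda of
`ManinPrimeToAdditiveFiveLe_of` is now `_` (file warning-free beyond its three `sorry`s); every
`def`/`theorem` statement is byte-identical to rev 1 (sha16 fd38074e63c06e11). P1 (non-vacuity) is paid
by the separate CHECKED file `Lines/regular_mult_one_nonvacuity.lean` (sorry-free); P2 by §«Stub 2
memo» of the card `Lines/regular-mult-one.md` rev 2; P3 by `Lines/regular-mult-one-F.md`.

## The near-miss and the single input

ENGINE (Agashe–Ribet–Stein 2012, Thm. 2.2 with Lemma 4.6 = Mazur's multiplicity one for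
differentials): for `p ∤ N` (and partially `p ∥ N`), `dim_{𝔽_p} H⁰(X₀(N)_{𝔽_p}, Ω)[𝔪] ≤ 1` for every
maximal ideal `𝔪 ∋ p` of the Hecke ring `T`, whence `T_𝔪`-cyclicity of `H¹(X₀(N), O)` and
`max(v_p(r_E) − v_p(m_E), v_p(c_E)) = 0`. MEASURED DEFICIT: the hypothesis `p² ∤ N` — at `p² ∣ N` the
special fibre `X₀(N)_{𝔽_p} = C_∞ ∪ C_0 ∪ Ξ` has the multiplicity-`(p−1)` component `Ξ` that neither the
`q`-expansion principle on `C_∞` nor the Atkin–Lehner transport `C_∞ ↔ C_0` reaches, and BOTH defects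
`v_p(r_E/m_E)` (242b1-type rows) and — conjecturally never — `v_p(c_E)` may open up. SINGLE INPUT TO
IMPROVE (this line's crux, `stub_regularMultOne`): multiplicity one on the REGULAR mod-`p`
differentials `H⁰(X₀(N)_{𝔽̄_p}, Ω) = Cot(𝒥₀(N)) ⊗ 𝔽̄_p` (ČNS: rational singularities at `p ≥ 5`) for the
NÉRON-ENLARGED algebra `A := T[ι ∘ π] ⊂ End J₀(N)` (`π : J₀(N) → E` optimal, `ι = π^∨`,
`ι ∘ π = m_E · e_f`), at the maximal ideal `𝔪_A = (𝔪_{ℤ̄_p}, T_ℓ − a_ℓ(f) ∀ ℓ, ιπ − m_E)`: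

  (K) `dim_{𝔽̄_p} (Cot ⊗ 𝔽̄_p)[𝔪_A] = 1`.

WHY THE ENLARGEMENT: multiplicity one for `T` itself at `p² ∣ N` would force `r_E =_p m_E` as well,
which is false in general at non-squarefree level (ARS12 §2: `ord_p(r_E/m_E) > 0` only if `p² ∣ 4N`,
and it happens); (K) asks only that the `ghost` eigen-differentials (those with zero `q`-expansion at
`∞`, supported on `C_0 ∪ Ξ`; they are the `𝔪_T`-socle of the Gabber–Edixhoven quotient
`Q = S₂(ℤ_p)/Cot`) have `f`-coordinate MORE singular than `p^{-v_p(m_E)}` — the ARS-defect ghosts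
`−v_p(r_E) ≤ v_p(λ_f) < −v_p(m_E)` are allowed. (K) is trivially true when `p ∤ m_E` (then
`ιπ − m_E ∈ 𝔪_A` forces `ḡ ≡ λ_f(g) f̄`), exactly the range where ČNS's `c ∣ deg φ` already gives C5.

## How (K) gives C5 (the Transfer, `stub_nakayamaTransfer`, size M)

`L := Cot^∨ = H¹(X₀(N)_{ℤ̄_p}, O) ⊇ End(J₀(N))_{ℤ̄_p} · a₁ ⊇ A · a₁` (Néron functoriality: every
endomorphism preserves `Cot 𝒥`), `a₁ ∉ 𝔪_A L` (`⟨a₁, f̄⟩ = 1`, `ω_f ∈ Cot` by ČNS Thm. 5.15). Grothendieck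
duality `(Cot ⊗ 𝔽̄_p)[𝔪_A] ≅ (L/𝔪_A L)^∨`, so (K) + Nakayama ⇒ `L_{𝔪_A} = A_{𝔪_A} · a₁` ⇒
`L ∩ ℚ̄_p λ_f = (A ∩ ℚ̄_p e_f) a₁ = m_E ℤ̄_p λ_f` (`A = T + m_E ℤ e_f`, `T ∩ ℚ e_f = r_E ℤ e_f`, `m_E ∣ r_E`)
⇒ the regular depth `b_p(L)` of the sibling line `neron_partner` equals `v_p(m_E)` ⇒ a Néron partner of
full depth exists (`NeronPartner.NeronPartnerDepth p N f (v_p m_E)`, after `w_N`-purification and a unit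
rescaling, both preserving `L`) ⇒ C5 by the sibling's sorry-free composition
`NeronPartner.ManinPrimeToAdditiveFiveLe_of` with its integrality stub (restated verbatim below as
`stub_neronIntegrality`, shared). So (K) ⇒ `partnerExists`: a STRONGER transfer, with a different
attack and a different, explicit failure mode (a ghost), decidable per level by linear algebra mod `p`.

## Currency

Everything is typed in the tree's ČNS cusp currency (`fourierCoeffAtCusp`, `cuspDenominator`,
`PadicAlgCl p ≃+* ℂ`, Prop. 5.14's three rows): for a fixed `ι`, `Reg_ι = Cot ⊗ ℤ̄_p` is the set of
cusp forms obeying Prop. 5.14's bounds at every cusp, `𝔪 · Reg_ι` the set obeying them with a uniform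
margin `s > 0`, the `𝔪_A`-torsion conditions are "`(T_ℓ − a_ℓ) g ∈ 𝔪 Reg`", "`(ιπ − m_E) g ∈ 𝔪 Reg`"
with `(ιπ)^* g = m_E λ_f(g) f`, and (K) reads "`⇒ g ≡ λ f (mod 𝔪 Reg)`". The tree has no Néron models;
the dictionary lives in the stubs' docstrings. Three stubs, sorry-free composition concluding the crux
BY NAME; `lean check` rc 0 with sorries only in `stub_*`. NOT registered (W-79).
-/

noncomputable section

open scoped MatrixGroups ModularForm

open CongruenceSubgroup UpperHalfPlane
open Literature.NumberTheory.EllipticCurves.ModularForms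
open Summit.BirchSwinnertonDyer.BirchSwinnertonDyer.Cruxes.ManinPrimeToAdditiveFiveLe.NeronPartner

set_option linter.dupNamespace false
set_option autoImplicit false

namespace Summit.BirchSwinnertonDyer.BirchSwinnertonDyer.Cruxes.ManinPrimeToAdditiveFiveLe.RegularMultOne

/-- ČNS Prop. 5.14 (p. 39) exponent: a cusp form `g` on `Γ₀(N)` extends to `X₀(N)_{ℤ̄_p}` (lies in the
Néron–de Rham lattice `Cot 𝒥₀(N) ⊗ ℤ̄_p`, `p ≥ 5`) iff at every cusp `γ∞` of denominator `L`,
`‖a_g(n; γ)‖_p ≤ p ^ e` with `e = v_p(N)` if `p ∤ L`, `e = v_p(N/L) − 1/(p−1)` if `0 < v_p(L) < v_p(N)`,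
`e = 0` if `v_p(L) = v_p(N)` (tree: the three proved rows `norm_fourierCoeffAtCusp_le_*` of
`NewformCuspFourierValuation.lean`, there for newforms; here as the DEFINING bound). -/
def prop514Exponent (p vL vN : ℕ) : ℝ :=
  if vL = 0 then (vN : ℝ) else if vL < vN then ((vN - vL : ℕ) : ℝ) - 1 / ((p : ℝ) - 1) else 0

/-- `IsRegAt N p ι h s`: through the fixed identification `ι : ℚ̄_p ≃ ℂ`, the function `h` (a cusp form of
weight `2` and level `Γ₀(N)`, coerced) satisfies ČNS Prop. 5.14's bounds at EVERY cusp with margin `s`: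
`‖ι⁻¹ a_h(n; γ)‖ ≤ p ^ (e(γ) − s)`. Margin `0` = `h ∈ Reg_ι = Cot 𝒥₀(N) ⊗ ℤ̄_p`; some margin `s > 0` =
`h ∈ 𝔪_{ℤ̄_p} · Reg_ι` (coordinates in a `ℤ_p`-basis of `Cot` all of norm `< 1`). -/
def IsRegAt (N p : ℕ) [Fact p.Prime] (ι : PadicAlgCl p ≃+* ℂ) (h : ℍ → ℂ) (s : ℝ) : Prop :=
  ∀ (γ : SL(2, ℤ)) (n : ℕ),
    ‖ι.symm (fourierCoeffAtCusp N 2 h γ n)‖ ≤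
      (p : ℝ) ^ (prop514Exponent p (padicValNat p (cuspDenominator N γ)) (padicValNat p N) - s)

/-- **(K) Regular multiplicity one for the Néron-enlarged Hecke algebra.** `RegularMultOne p N f m`:
for every `ι` and every regular `g` (`g ∈ Reg_ι`) which is `𝔪_A`-torsion modulo `𝔪 Reg_ι` — i.e.
`(T_ℓ − a_ℓ(f)) g ∈ 𝔪 Reg_ι` for every prime `ℓ` (`a_ℓ(f)` = the eigenvalue of `f`, `U_ℓ` at `ℓ ∣ N`),
and `((ιπ)^* − m) g = m λ f − m g ∈ 𝔪 Reg_ι` where `λ f` is the orthogonal projection of `g` on `ℂ f`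
(`⟨f, g − λ f⟩ = 0`) and `m` the modular degree (`(ι∘π)^* = m · e_f` on cusp forms) — `g` is a scalar
multiple of `f` modulo `𝔪 Reg_ι`. Informally: `dim_{𝔽̄_p} (Cot 𝒥₀(N) ⊗ 𝔽̄_p)[𝔪_{T[ιπ]}] = 1`. Trivially
true when `p ∤ m`. -/
def RegularMultOne (p N : ℕ) [Fact p.Prime] [NeZero N] (f : CuspForm (Gamma0 N) 2) (m : ℕ) : Prop :=
  ∀ (ι : PadicAlgCl p ≃+* ℂ) (g : CuspForm (Gamma0 N) 2) (c : ℂ),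
    IsRegAt N p ι ⇑g 0 →
    peterssonProduct (Gamma0 N) 2 f (g - c • f) = 0 →
    (∀ (ℓ : ℕ) [NeZero ℓ], ℓ.Prime → ∃ a : ℂ, heckeT (Gamma0 N) 2 ℓ f = a • f ∧
        ∃ s : ℝ, 0 < s ∧ IsRegAt N p ι (⇑(heckeT (Gamma0 N) 2 ℓ g) - a • ⇑g) s) →
    (∃ s : ℝ, 0 < s ∧ IsRegAt N p ι (((m : ℂ) * c) • ⇑f - (m : ℂ) • ⇑g) s) →
    ∃ (d : ℂ) (s : ℝ), 0 < s ∧ IsRegAt N p ι (⇑g - d • ⇑f) s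

/-- **Stub 1 (shared with the sibling line `neron_partner`, verbatim; ČNS mechanism on an arbitrary
lattice element; L).** `NeronPartnerDepth p N D.f k ⇒ k + v_p(c) ≤ v_p(deg)`: Prop. 5.14 ⇒ `η ∈ Cot 𝒥`
(rational singularities, `p ≥ 5`) ⇒ Néron functoriality of `φ^∨` ⇒ `(φ^∨)^* η = λ_f(η)(deg/c) ω_E ∈ ℤ_(p) ω_E`.
Uniform in `ρ̄_{E,p}`. Cited, not re-derived: `Lines/neron_partner.lean` (bsd-idea-19 g3) `stub_neronIntegrality`. -/
theorem stub_neronIntegrality :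
    exists_isNewformOf →
    ∀ (W : WeierstrassCurve ℚ) [W.IsElliptic] [W.IsGloballyMinimal] {N : ℕ} [NeZero N]
      (D : ModularParametrizationData W N),
      (∀ z ∈ D.L.lattice, ∃ w ∈ periodLattice D.f, z = D.c * w) →
      ∀ (p : ℕ) [Fact p.Prime], 5 ≤ p → p ^ 2 ∣ N → ∀ k : ℕ,
        NeronPartnerDepth p N D.f k →
          (k : ℤ) + padicValInt p D.maninConstant ≤ (padicValNat p D.modularDegree : ℤ) := by
  sorry

/-- **Stub 2 (the Transfer (K) ⇒ full Betti depth; commutative algebra + duality; M).** For the newform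
`f = D.f` of an optimal curve, regular multiplicity one for `T[ιπ]` gives a Néron partner of depth
`v_p(deg φ)`. Proof sketch (docstring of the module): `Reg_ι = Cot ⊗ ℤ̄_p` is free of rank `dim S₂`
(ČNS Prop. 5.14 both directions + Thm. 5.15 for `ω_f`); Grothendieck duality `(Cot ⊗ 𝔽̄_p)[𝔪_A] ≅ (L/𝔪_A L)^∨`
with `L = Cot^∨ ⊇ A · a₁`, `a₁ ∉ 𝔪_A L`; Nakayama ⇒ `L_{𝔪_A} = A_{𝔪_A} a₁` ⇒ `L ∩ ℚ̄_p λ_f = m ℤ̄_p λ_f`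
(`A ∩ ℚ̄ e_f = m ℤ e_f` from `A = T + m ℤ e_f`, `T ∩ ℚ e_f = r ℤ e_f`, `m ∣ r`) ⇒ some `η ∈ Cot 𝒥_{ℤ_(p)}`
(rational `q`-expansion; depth is invariant under `⊗ ℤ̄_p`) has `λ_f(η) = u p^{-v_p(m)}`, `u ∈ ℤ_(p)^×`;
`w_N`-purify (`w_N` preserves `Cot` and `λ_f`, `w_N f = ε f`) and rescale by `u⁻¹`; the three cusp clauses of
`NeronPartnerDepth` are Prop. 5.14 (⇒) for `η`. No BLR / closed-immersion input. -/
theorem stub_nakayamaTransfer :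
    exists_isNewformOf →
    ∀ (W : WeierstrassCurve ℚ) [W.IsElliptic] [W.IsGloballyMinimal] {N : ℕ} [NeZero N]
      (D : ModularParametrizationData W N),
      (∀ z ∈ D.L.lattice, ∃ w ∈ periodLattice D.f, z = D.c * w) →
      ∀ (p : ℕ) [Fact p.Prime], 5 ≤ p → p ^ 2 ∣ N →
        RegularMultOne p N D.f D.modularDegree →
          NeronPartnerDepth p N D.f (padicValNat p D.modularDegree) := by
  sorry

/-- **Stub 3 (THE CRUX of this line = the single input the ARS engine lacks at `p² ∣ N`; open).** For the
newform of an OPTIMAL elliptic curve (lattice clause) and a prime `p ≥ 5` with `p² ∣ N`: regular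
multiplicity one for the Néron-enlarged algebra, `dim (Cot 𝒥₀(N) ⊗ 𝔽̄_p)[𝔪_{T[ιπ]}] = 1`. Attack: the
`q`-expansion principle on `C_∞` makes every `𝔪_A`-torsion class `ḡ − λ f̄` a GHOST (zero expansion at `∞`,
supported on `C_0 ∪ Ξ`; ghosts = `Q[𝔪_T]`, `Q = S₂(ℤ_p)/Cot`); `w_N` (an automorphism of `X₀(N)_{ℤ_p}` fixing
`Ξ`, commuting with `T_ℓ` (`ℓ ∤ N`) and with `ιπ` up to `ε² = 1`) moves `C_0`-ghosts to `C_∞`, where they become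
mod-`p` `T^{(N)}`-eigenforms on `X₀(M)_{𝔽_p}` with poles of bounded order at supersingular points, i.e. (× Hasse)
holomorphic mod-`p` eigenforms of level `M` PRIME TO `p` and weight `2 + j(p−1) ≤ 2p`, with `f`'s eigenvalues away
from `N` — excluded by Serre weights when `ρ̄_{f,p}` is irreducible of Serre weight `> 2p` (Edixhoven's range), and on
the Eisenstein rows (the route's residual R: `p ∈ {5,7,13}`, `ρ̄` reducible) reduced to the NON-EXISTENCE of
cuspidal-Eisenstein congruences of level `M`, weight `≤ 2p`, nebentype data of the row, that ALSO satisfy `U_p ≡ 0`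
and the `(ιπ)`-clause `v_p(λ_f) ≥ −v_p(m_E)` — an explicit Bernoulli-number / Euler-factor condition per row; the
`Ξ`-ghosts are Igusa-level objects handled the same way. Why it might fail: a genuine ghost at some `p² M` (then (K)
is false there while C5 may still hold — the ghost is an explicit certificate and names the obstruction for the
sibling's `partnerExists` too). Cheapest falsifier: `dim_{𝔽_p}` of the `𝔪_A`-eigenspace in the mod-`p` reduction of
the cusp-content lattice `L` on `50a1, 75a1, 150a1, 175a1, 225a1, 245a1, 338a1, 450b1` (extends kit test F3 of
`Lines/neron-partner-F3.md` by one rank computation). -/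
theorem stub_regularMultOne :
    exists_isNewformOf →
    ∀ (W : WeierstrassCurve ℚ) [W.IsElliptic] [W.IsGloballyMinimal] {N : ℕ} [NeZero N]
      (D : ModularParametrizationData W N),
      (∀ z ∈ D.L.lattice, ∃ w ∈ periodLattice D.f, z = D.c * w) →
      ∀ (p : ℕ) [Fact p.Prime], 5 ≤ p → p ^ 2 ∣ N →
        RegularMultOne p N D.f D.modularDegree := by
  sorry

/-- **Composition (sorry-free): the three stubs give the crux BY NAME**, through the sibling line's
sorry-free `NeronPartner.ManinPrimeToAdditiveFiveLe_of` (identity stub + full-depth partner ⇒ `v_p(c) ≤ 0`,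
`c ≠ 0`). -/
theorem ManinPrimeToAdditiveFiveLe_of
    (h₁ : exists_isNewformOf →
      ∀ (W : WeierstrassCurve ℚ) [W.IsElliptic] [W.IsGloballyMinimal] {N : ℕ} [NeZero N]
        (D : ModularParametrizationData W N),
        (∀ z ∈ D.L.lattice, ∃ w ∈ periodLattice D.f, z = D.c * w) →
        ∀ (p : ℕ) [Fact p.Prime], 5 ≤ p → p ^ 2 ∣ N → ∀ k : ℕ,
          NeronPartnerDepth p N D.f k →
            (k : ℤ) + padicValInt p D.maninConstant ≤ (padicValNat p D.modularDegree : ℤ))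
    (h₂ : exists_isNewformOf →
      ∀ (W : WeierstrassCurve ℚ) [W.IsElliptic] [W.IsGloballyMinimal] {N : ℕ} [NeZero N]
        (D : ModularParametrizationData W N),
        (∀ z ∈ D.L.lattice, ∃ w ∈ periodLattice D.f, z = D.c * w) →
        ∀ (p : ℕ) [Fact p.Prime], 5 ≤ p → p ^ 2 ∣ N →
          RegularMultOne p N D.f D.modularDegree →
            NeronPartnerDepth p N D.f (padicValNat p D.modularDegree))
    (h₃ : exists_isNewformOf →
      ∀ (W : WeierstrassCurve ℚ) [W.IsElliptic] [W.IsGloballyMinimal] {N : ℕ} [NeZero N]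
        (D : ModularParametrizationData W N),
        (∀ z ∈ D.L.lattice, ∃ w ∈ periodLattice D.f, z = D.c * w) →
        ∀ (p : ℕ) [Fact p.Prime], 5 ≤ p → p ^ 2 ∣ N →
          RegularMultOne p N D.f D.modularDegree) :
    Summit.BirchSwinnertonDyer.BirchSwinnertonDyer.Theses.ManinLocalTwoThree.ManinPrimeToAdditiveFiveLe :=
  NeronPartner.ManinPrimeToAdditiveFiveLe_of h₁
    (fun hnf W _ _ _ _ D hopt p _ hp5 hpN ↦ h₂ hnf W D hopt p hp5 hpN (h₃ hnf W D hopt p hp5 hpN))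

/-- The same composition applied to the stubs themselves (audit: the only `sorry`s are the three stubs). -/
theorem ManinPrimeToAdditiveFiveLe_of_stubs :
    Summit.BirchSwinnertonDyer.BirchSwinnertonDyer.Theses.ManinLocalTwoThree.ManinPrimeToAdditiveFiveLe :=
  ManinPrimeToAdditiveFiveLe_of stub_neronIntegrality stub_nakayamaTransfer stub_regularMultOne


/-! ## Non-vacuity of the hypothesis package of (K) — critic V#111 price P1, CHECKED (rev 1.1)

The vacuity watch: `RegularMultOne p N f m` quantifies over `ι`, `g`, `c` subject to four hypotheses;
if no `(ι, g, c)` satisfied them, (K) would be vacuously true and `stub_nakayamaTransfer` would silently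
carry everything. Below, SORRY-FREE: for a newform `f` (`IsNewform0 f`, supplied for a datum `D` by
`D.isNewformOf.1`) and the ČNS named fact `cesnaviciusNeururerSaha_cor_4_7` (the fact the sibling lines
use), the triple `(ι, g := f, c := 1)` satisfies all four hypotheses for EVERY `ι : ℚ̄_p ≃+* ℂ`, and such
`ι` exist. V#111 items: (i) `heckeT (Gamma0 N) 2 ℓ f = a_ℓ • f` for every prime `ℓ` INCLUDING `ℓ ∣ N`
(the tree's `heckeT` at `ℓ ∣ N` is `U_ℓ`; the newform is its eigenvector) = tree theorem
`IsNewform0.heckeT_eq_coeff_smul` (NewformsHeckeProofs, from Diamond–Shurman Prop. 5.8.5);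
(ii) `IsRegAt N p ι ⇑f 0` = the three PROVED Prop. 5.14 rows
`norm_fourierCoeffAtCusp_le_pow_of_padicValNat_eq_zero` / `…_le_rpow_of_pos_of_lt` /
`…_le_one_of_padicValNat_eq` (NewformCuspFourierValuation) — `prop514Exponent` is typed to be exactly
their three exponents, and `cuspDenominator_dvd` gives `v_p(L) ≤ v_p(N)`; (iii) an inhabitant of
`PadicAlgCl p ≃+* ℂ` = `PadicAlgCl.nonempty_ringEquiv_complex`. With `g = f` the conclusion of (K) is
of course trivial (`d = 1`); non-vacuity is all that is claimed here. -/

section NonVacuity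

/-- (iii) Isomorphisms `ℚ̄_p ≃+* ℂ` exist (tree: `PadicAlgCl.nonempty_ringEquiv_complex`). [folklore] -/
theorem nonempty_iota (p : ℕ) [Fact p.Prime] : Nonempty (PadicAlgCl p ≃+* ℂ) :=
  PadicAlgCl.nonempty_ringEquiv_complex p

/-- The Fourier coefficients of the zero function at every cusp vanish. [folklore] -/
theorem fourierCoeffAtCusp_zero (N : ℕ) (k : ℤ) (γ : SL(2, ℤ)) (n : ℕ) :
    fourierCoeffAtCusp N k (0 : ℍ → ℂ) γ n = 0 := by
  simp [fourierCoeffAtCusp, SlashAction.zero_slash, qExpansion_zero]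

/-- The zero function is regular with ANY margin `s` (its coefficients are `0`). [folklore] -/
theorem isRegAt_zero (N : ℕ) {p : ℕ} [Fact p.Prime] (ι : PadicAlgCl p ≃+* ℂ) (s : ℝ) :
    IsRegAt N p ι (0 : ℍ → ℂ) s := by
  intro γ n
  rw [fourierCoeffAtCusp_zero, map_zero, norm_zero]
  exact Real.rpow_nonneg (Nat.cast_nonneg p) _

/-- (ii) **A newform is regular with margin `0`** (`f ∈ Reg_ι = Cot ⊗ ℤ̄_p`): the three ČNS Prop. 5.14
rows, proved in the tree from the named fact Cor. 4.7, are exactly the three branches of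
`prop514Exponent`. [cite: CesnaviciusNeururerSaha2023, Prop. 5.14 (p. 39); Cor. 4.7 (p. 31)] -/
theorem isRegAt_newform (h47 : cesnaviciusNeururerSaha_cor_4_7) {N : ℕ} [NeZero N] {p : ℕ}
    [Fact p.Prime] (f : CuspForm (Gamma0 N) 2) (hf : IsNewform0 f) (ι : PadicAlgCl p ≃+* ℂ) :
    IsRegAt N p ι ⇑f 0 := by
  have hmem : f ∈ Submodule.span ℤ (newforms0 N 2) := Submodule.subset_span hf
  have hp : (p : ℝ) ≠ 0 := Nat.cast_ne_zero.mpr (Fact.out : p.Prime).ne_zero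
  intro γ n
  rw [sub_zero]
  have hle : padicValNat p (cuspDenominator N γ) ≤ padicValNat p N :=
    (padicValNat_dvd_iff_le (NeZero.ne N)).mp (pow_padicValNat_dvd.trans (cuspDenominator_dvd N γ))
  unfold prop514Exponent
  by_cases h0 : padicValNat p (cuspDenominator N γ) = 0
  · rw [if_pos h0, Real.rpow_natCast]
    exact norm_fourierCoeffAtCusp_le_pow_of_padicValNat_eq_zero h47 f hmem γ ι n h0
  · rw [if_neg h0]
    by_cases hlt : padicValNat p (cuspDenominator N γ) < padicValNat p N
    · rw [if_pos hlt]
      exact norm_fourierCoeffAtCusp_le_rpow_of_pos_of_lt h47 f hmem γ ι n (Nat.pos_of_ne_zero h0) hlt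
    · rw [if_neg hlt, Real.rpow_zero]
      exact norm_fourierCoeffAtCusp_le_one_of_padicValNat_eq h47 f hmem γ ι n
        (le_antisymm hle (not_lt.mp hlt))

/-- (i)+(ii)+(iii) **The hypothesis package of (K) is inhabited**: for a newform `f` and any
`ι : ℚ̄_p ≃+* ℂ`, the triple `(ι, g := f, c := 1)` satisfies the four hypotheses of
`RegularMultOne p N f m` — regularity of `g`, the Petersson pinning of `c`, the Hecke clauses for
EVERY prime `ℓ` (incl. `ℓ ∣ N`, where the tree's `heckeT` is `U_ℓ` and `IsNewform0.heckeT_eq_coeff_smul`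
still applies), and the `(ι∘π)`-clause — so (K) is not vacuously true. [folklore] -/
theorem regularMultOne_hypotheses_inhabited (h47 : cesnaviciusNeururerSaha_cor_4_7) {N : ℕ}
    [NeZero N] {p : ℕ} [Fact p.Prime] (f : CuspForm (Gamma0 N) 2) (hf : IsNewform0 f)
    (ι : PadicAlgCl p ≃+* ℂ) (m : ℕ) :
    IsRegAt N p ι ⇑f 0 ∧
    peterssonProduct (Gamma0 N) 2 f (f - (1 : ℂ) • f) = 0 ∧
    (∀ (ℓ : ℕ) [NeZero ℓ], ℓ.Prime → ∃ a : ℂ, heckeT (Gamma0 N) 2 ℓ f = a • f ∧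
        ∃ s : ℝ, 0 < s ∧ IsRegAt N p ι (⇑(heckeT (Gamma0 N) 2 ℓ f) - a • ⇑f) s) ∧
    (∃ s : ℝ, 0 < s ∧ IsRegAt N p ι ((((m : ℂ) * 1) • ⇑f - (m : ℂ) • ⇑f)) s) := by
  refine ⟨isRegAt_newform h47 f hf ι, ?_, ?_, ?_⟩
  · rw [one_smul, sub_self, ← peterssonProductₗ_apply, map_zero]
  · intro ℓ _ hℓ
    refine ⟨(qExpansion 1 ⇑f).coeff ℓ, hf.heckeT_eq_coeff_smul hℓ, 1, one_pos, ?_⟩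
    have h0 : ⇑(heckeT (Gamma0 N) 2 ℓ f) - ((qExpansion 1 ⇑f).coeff ℓ) • (⇑f : ℍ → ℂ) = 0 := by
      rw [hf.heckeT_eq_coeff_smul hℓ]
      ext z
      simp
    rw [h0]
    exact isRegAt_zero N ι 1
  · refine ⟨1, one_pos, ?_⟩
    have h0 : (((m : ℂ) * 1) • (⇑f : ℍ → ℂ) - (m : ℂ) • (⇑f : ℍ → ℂ)) = 0 := by
      rw [mul_one, sub_self]
    rw [h0]
    exact isRegAt_zero N ι 1

/-- **Instance at a modular parametrisation datum** (the shape in which stub 3 quantifies): for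
`D : ModularParametrizationData W N`, `D.f` is a newform (`D.isNewformOf.1`), so the package is
inhabited at `(ι, D.f, 1)` for every `ι`, every `p`, every `m` (in particular `m = D.modularDegree`).
[folklore] -/
theorem regularMultOne_hypotheses_inhabited_datum (h47 : cesnaviciusNeururerSaha_cor_4_7)
    {N : ℕ} [NeZero N] {p : ℕ} [Fact p.Prime] (W : WeierstrassCurve ℚ) [W.IsElliptic]
    (D : ModularParametrizationData W N) (ι : PadicAlgCl p ≃+* ℂ) :
    IsRegAt N p ι ⇑D.f 0 ∧
    peterssonProduct (Gamma0 N) 2 D.f (D.f - (1 : ℂ) • D.f) = 0 ∧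
    (∀ (ℓ : ℕ) [NeZero ℓ], ℓ.Prime → ∃ a : ℂ, heckeT (Gamma0 N) 2 ℓ D.f = a • D.f ∧
        ∃ s : ℝ, 0 < s ∧ IsRegAt N p ι (⇑(heckeT (Gamma0 N) 2 ℓ D.f) - a • ⇑D.f) s) ∧
    (∃ s : ℝ, 0 < s ∧
      IsRegAt N p ι ((((D.modularDegree : ℂ) * 1) • ⇑D.f - (D.modularDegree : ℂ) • ⇑D.f)) s) :=
  regularMultOne_hypotheses_inhabited h47 D.f D.isNewformOf.1 ι D.modularDegree

end NonVacuity

end Summit.BirchSwinnertonDyer.BirchSwinnertonDyer.Cruxes.ManinPrimeToAdditiveFiveLe.RegularMultOne
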